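import Summits.AtomisticToContinuum.Crystallization.Theorems.ChartedZeroExcessLayeredLatticeLiouvilleUS

/-!
# Zero-excess layered lattice Liouville — part UT (lens-2 g57, node «DirichletSolve» 1/2): the truncated Dirichlet form.

Continuation of part US (critic row 889: «PROVE (PT) outright (S), then (HC)»).  Parts UT + UU close the piece (HC) `HarmonicComparisonZ` of the
SB-glue (part UR) by finite-dimensional Lax–Milgram for the `ϱ`-truncated linearised operator of a certified laminate [giaquinta1984 Ch. III, proof
of Thm 2.2 (fn. 9) + energy identity (2.13)]; this part sets up the finite-dimensional objects, part UU proves `harmonicComparisonZ_holds`.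
CONTENT.  UT.1 the truncated kernel `nearK X Y` of a bond in index form (= the summand of `truncResidual` / `IsTruncHarmonicZ`), its BOND REVERSAL
SYMMETRY `nearK_comm` (`forceConst` even, part B), and `truncResidual` as a FINITE index sum `Σ_Y nearK X Y (φ Y − φ X)` (co-Lipschitz ⇒ finitely
many near sites, part US) — hence LINEAR (`truncResidual_add/_smul/_sub`).  UT.2 extension by zero `extP` of a field on a finite index set `N` and
the restricted LINEAR OPERATOR `resOp : (N → E3) →ₗ[ℝ] (N → E3)` (the Dirichlet operator).  UT.3 the finite neighbourhoods `nearSet` (model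
distance `ϱ`) and `nbSet` (index distance `1`) of a finite index set.  UT.4 for a field supported in a finite set, `nnFormZ` and `idxEnergy` are
finite sums of the same nonnegative summand, `idxEnergy ≤ nnFormZ` (`idxEnergy_le_nnFormZ`), and POSITIVITY `eq_zero_of_nnFormZ_eq_zero` (all
index-nearest-neighbour increments vanish ⇒ constant along the layer ray `m ↦ m + n`, which leaves the finite set).  UT.5 the `CoerciveZ` pair family
splits as near + far (`pairFam_eq_add`); the near family is supported in `nearSet × nearSet`, the far family is absolutely summable and `≤ ε·nnFormZ`
by (T) (`|⟪u, K u⟫| ≤ ‖K‖‖u‖²`); ★ `truncForm_coercive`: `(2κ₀ − ε)·nnFormZ χ ≤ Q_ϱ(χ) := Σ_{(X,Y)} ⟪χ Y − χ X, nearK X Y (χ Y − χ X)⟫`.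
No statement of the column is re-typed here; `IsTameIndexing` is not used.
-/

noncomputable section

open scoped BigOperators InnerProductSpace RealInnerProductSpace
open MeasureTheory Set Metric Filter Topology
open Summit.AtomisticToContinuum.Crystallization.Theorems.ChartedPlanarOrderRigidityDoor (E3 IsNash atomsIn)
open Summit.AtomisticToContinuum.Crystallization.Theorems.ChartedPlanarOrderDensityDichotomy (μS IsSep nK nK_nonneg)
open Summit.AtomisticToContinuum.Crystallization.Theorems.ChartedPlanarOrderDoorLayered (Layered layeredHom_eq_layered)

namespace Summit.AtomisticToContinuum.Crystallization.Theorems.ChartedZeroExcessLayeredLatticeLiouville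

section DirichletSolve

variable {c : ℝ} {a b : E3} {w : ℤ → E3}

/-! ### UT.1  The truncated kernel in index form; the residual is a finite, linear index sum -/

/-- the `ϱ`-truncated linearised kernel of the bond `X → Y`, applied to `u` (the summand of `truncResidual` / `IsTruncHarmonicZ`). [this file, g57] -/
def nearK (ϱ : ℝ) (a b : E3) (w : ℤ → E3) (X Y : Cell 2 × ℤ) (u : E3) : E3 :=
  if ϱ < ‖lsite a b w Y.1 Y.2 - lsite a b w X.1 X.2‖ then 0 else layeredKernel a b w (Y.1 - X.1) X.2 Y.2 u

/-- `nearK` is additive. [formal bookkeeping] -/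
theorem nearK_add (ϱ : ℝ) (a b : E3) (w : ℤ → E3) (X Y : Cell 2 × ℤ) (u v : E3) :
    nearK ϱ a b w X Y (u + v) = nearK ϱ a b w X Y u + nearK ϱ a b w X Y v := by
  unfold nearK; split_ifs <;> simp

/-- `nearK` commutes with scalars. [formal bookkeeping] -/
theorem nearK_smul (ϱ : ℝ) (a b : E3) (w : ℤ → E3) (X Y : Cell 2 × ℤ) (r : ℝ) (u : E3) :
    nearK ϱ a b w X Y (r • u) = r • nearK ϱ a b w X Y u := by
  unfold nearK; split_ifs <;> simp

/-- `nearK` commutes with negation. [formal bookkeeping] -/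
theorem nearK_neg (ϱ : ℝ) (a b : E3) (w : ℤ → E3) (X Y : Cell 2 × ℤ) (u : E3) :
    nearK ϱ a b w X Y (-u) = -nearK ϱ a b w X Y u := by
  unfold nearK; split_ifs <;> simp

/-- BOND REVERSAL SYMMETRY of the truncated kernel (`forceConst` is even, part B). [this file, g57] -/
theorem nearK_comm (ϱ : ℝ) (a b : E3) (w : ℤ → E3) (X Y : Cell 2 × ℤ) (u : E3) :
    nearK ϱ a b w Y X u = nearK ϱ a b w X Y u := by
  unfold nearK
  rw [norm_sub_rev (lsite a b w X.1 X.2) (lsite a b w Y.1 Y.2), layeredKernel_sub_fst_eq a b w Y X,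
    layeredKernel_sub_fst_eq a b w X Y]
  by_cases hϱ : ϱ < ‖lsite a b w Y.1 Y.2 - lsite a b w X.1 X.2‖
  · rw [if_pos hϱ, if_pos hϱ]
  · rw [if_neg hϱ, if_neg hϱ]
    by_cases hXY : X = Y
    · subst hXY
      simp
    · rw [if_neg hXY, if_neg (Ne.symm hXY), ← neg_sub (lsite a b w Y.1 Y.2) (lsite a b w X.1 X.2), forceConst_neg]

/-- the truncated residual as a finite index sum of `nearK` over any finset containing the near sites. [this file, g57] -/
theorem truncResidual_eq_sum_nearK {ϱ : ℝ} {X : Cell 2 × ℤ} {N : Finset (Cell 2 × ℤ)}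
    (hN : ∀ Y : Cell 2 × ℤ, ‖lsite a b w Y.1 Y.2 - lsite a b w X.1 X.2‖ ≤ ϱ → Y ∈ N) (φ : Cell 2 → ℤ → E3) :
    truncResidual ϱ a b w φ X = ∑ Y ∈ N, nearK ϱ a b w X Y (φ Y.1 Y.2 - φ X.1 X.2) := by
  unfold truncResidual nearK
  exact tsum_eq_sum fun Y hY => if_pos (not_le.mp fun h' => hY (hN Y h'))

/-- linearity of the truncated residual (co-Lipschitz crystal): additivity. [this file, g57] -/
theorem truncResidual_add (hc : 0 < c) (hL : IsLayeredCrystal c a b w) (ϱ : ℝ) (φ ψ : Cell 2 → ℤ → E3) (X : Cell 2 × ℤ) :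
    truncResidual ϱ a b w (φ + ψ) X = truncResidual ϱ a b w φ X + truncResidual ϱ a b w ψ X := by
  have hfin := finite_near_lsite hc hL X ϱ
  have hN : ∀ Y : Cell 2 × ℤ, ‖lsite a b w Y.1 Y.2 - lsite a b w X.1 X.2‖ ≤ ϱ → Y ∈ hfin.toFinset :=
    fun Y hY => hfin.mem_toFinset.mpr hY
  rw [truncResidual_eq_sum_nearK hN, truncResidual_eq_sum_nearK hN, truncResidual_eq_sum_nearK hN, ← Finset.sum_add_distrib]
  refine Finset.sum_congr rfl fun Y _ => ?_
  rw [← nearK_add]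
  congr 1
  simp only [Pi.add_apply]
  abel

/-- linearity of the truncated residual: homogeneity. [this file, g57] -/
theorem truncResidual_smul (hc : 0 < c) (hL : IsLayeredCrystal c a b w) (ϱ : ℝ) (r : ℝ) (φ : Cell 2 → ℤ → E3) (X : Cell 2 × ℤ) :
    truncResidual ϱ a b w (r • φ) X = r • truncResidual ϱ a b w φ X := by
  have hfin := finite_near_lsite hc hL X ϱ
  have hN : ∀ Y : Cell 2 × ℤ, ‖lsite a b w Y.1 Y.2 - lsite a b w X.1 X.2‖ ≤ ϱ → Y ∈ hfin.toFinset :=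
    fun Y hY => hfin.mem_toFinset.mpr hY
  rw [truncResidual_eq_sum_nearK hN, truncResidual_eq_sum_nearK hN, Finset.smul_sum]
  refine Finset.sum_congr rfl fun Y _ => ?_
  rw [← nearK_smul]
  congr 1
  simp only [Pi.smul_apply]
  rw [smul_sub]

/-- linearity of the truncated residual: differences. [this file, g57] -/
theorem truncResidual_sub (hc : 0 < c) (hL : IsLayeredCrystal c a b w) (ϱ : ℝ) (φ ψ : Cell 2 → ℤ → E3) (X : Cell 2 × ℤ) :
    truncResidual ϱ a b w (φ - ψ) X = truncResidual ϱ a b w φ X - truncResidual ϱ a b w ψ X := by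
  have hfin := finite_near_lsite hc hL X ϱ
  have hN : ∀ Y : Cell 2 × ℤ, ‖lsite a b w Y.1 Y.2 - lsite a b w X.1 X.2‖ ≤ ϱ → Y ∈ hfin.toFinset :=
    fun Y hY => hfin.mem_toFinset.mpr hY
  rw [truncResidual_eq_sum_nearK hN, truncResidual_eq_sum_nearK hN, truncResidual_eq_sum_nearK hN, ← Finset.sum_sub_distrib]
  refine Finset.sum_congr rfl fun Y _ => ?_
  rw [eq_sub_iff_add_eq, ← nearK_add]
  congr 1
  simp only [Pi.sub_apply]
  abel

/-! ### UT.2  Fields supported in a finite index set: extension by zero and the restricted operator -/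

/-- extension by zero of a field given on the finite index set `N` (a copy of `N → E3` inside the index fields). [this file, g57] -/
def extP (N : Finset (Cell 2 × ℤ)) (g : ↥N → E3) : Cell 2 → ℤ → E3 :=
  fun γ m => if h : (γ, m) ∈ N then g ⟨(γ, m), h⟩ else 0

/-- `extP` on a member of the index set. [formal bookkeeping] -/
theorem extP_apply_of_mem {N : Finset (Cell 2 × ℤ)} (g : ↥N → E3) {X : Cell 2 × ℤ} (h : X ∈ N) :
    extP N g X.1 X.2 = g ⟨X, h⟩ := by
  unfold extP
  rw [dif_pos (show (X.1, X.2) ∈ N from h)]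

/-- `extP` vanishes off the index set. [formal bookkeeping] -/
theorem extP_apply_of_not_mem {N : Finset (Cell 2 × ℤ)} (g : ↥N → E3) {X : Cell 2 × ℤ} (h : X ∉ N) :
    extP N g X.1 X.2 = 0 := by
  unfold extP
  rw [dif_neg (show (X.1, X.2) ∉ N from h)]

/-- `extP` is additive. [formal bookkeeping] -/
theorem extP_add {N : Finset (Cell 2 × ℤ)} (g₁ g₂ : ↥N → E3) : extP N (g₁ + g₂) = extP N g₁ + extP N g₂ := by
  funext γ m
  simp only [extP, Pi.add_apply]
  split_ifs <;> simp

/-- `extP` commutes with scalars. [formal bookkeeping] -/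
theorem extP_smul {N : Finset (Cell 2 × ℤ)} (r : ℝ) (g : ↥N → E3) : extP N (r • g) = r • extP N g := by
  funext γ m
  simp only [extP, Pi.smul_apply]
  split_ifs <;> simp

/-- ★ the truncated residual as a LINEAR OPERATOR on the fields supported in the finite index set `N`, restricted back to `N`
(the finite-dimensional Dirichlet operator). [this file, g57] -/
def resOp (hc : 0 < c) (hL : IsLayeredCrystal c a b w) (ϱ : ℝ) (N : Finset (Cell 2 × ℤ)) :
    (↥N → E3) →ₗ[ℝ] (↥N → E3) where
  toFun g := fun p => truncResidual ϱ a b w (extP N g) (p : Cell 2 × ℤ)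
  map_add' g₁ g₂ := by
    funext p
    show truncResidual ϱ a b w (extP N (g₁ + g₂)) (p : Cell 2 × ℤ) =
      truncResidual ϱ a b w (extP N g₁) (p : Cell 2 × ℤ) + truncResidual ϱ a b w (extP N g₂) (p : Cell 2 × ℤ)
    rw [extP_add, truncResidual_add hc hL]
  map_smul' r g := by
    funext p
    show truncResidual ϱ a b w (extP N (r • g)) (p : Cell 2 × ℤ) = r • truncResidual ϱ a b w (extP N g) (p : Cell 2 × ℤ)
    rw [extP_smul, truncResidual_smul hc hL]

/-- Unfolding lemma for `resOp`. [formal bookkeeping] -/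
theorem resOp_apply (hc : 0 < c) (hL : IsLayeredCrystal c a b w) (ϱ : ℝ) (N : Finset (Cell 2 × ℤ)) (g : ↥N → E3) (p : ↥N) :
    resOp hc hL ϱ N g p = truncResidual ϱ a b w (extP N g) (p : Cell 2 × ℤ) := rfl

/-! ### UT.3  Finite neighbourhoods of a finite index set -/

/-- the sites within model distance `ϱ` of some site of `N₀` (finite). [this file, g57] -/
def nearSet (hc : 0 < c) (hL : IsLayeredCrystal c a b w) (ϱ : ℝ) (N₀ : Finset (Cell 2 × ℤ)) : Finset (Cell 2 × ℤ) :=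
  N₀.biUnion fun X => (finite_near_lsite hc hL X ϱ).toFinset

/-- Membership in `nearSet` from the defining bound. [formal bookkeeping] -/
theorem mem_nearSet_of (hc : 0 < c) (hL : IsLayeredCrystal c a b w) {ϱ : ℝ} {N₀ : Finset (Cell 2 × ℤ)} {X Y : Cell 2 × ℤ}
    (hX : X ∈ N₀) (hY : ‖lsite a b w Y.1 Y.2 - lsite a b w X.1 X.2‖ ≤ ϱ) : Y ∈ nearSet hc hL ϱ N₀ :=
  Finset.mem_biUnion.mpr ⟨X, hX, (finite_near_lsite hc hL X ϱ).mem_toFinset.mpr hY⟩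

/-- A site is near itself. [formal bookkeeping] -/
theorem mem_nearSet_self (hc : 0 < c) (hL : IsLayeredCrystal c a b w) {ϱ : ℝ} (hϱ : 0 ≤ ϱ) {N₀ : Finset (Cell 2 × ℤ)}
    {X : Cell 2 × ℤ} (hX : X ∈ N₀) : X ∈ nearSet hc hL ϱ N₀ :=
  mem_nearSet_of hc hL hX (by rw [sub_self, norm_zero]; exact hϱ)

/-- the sites within index distance `1` of some site of `N₀` (finite). [this file, g57] -/
def nbSet (N₀ : Finset (Cell 2 × ℤ)) : Finset (Cell 2 × ℤ) :=
  N₀.biUnion fun X => ((isCompact_closedBall X (1 : ℝ)).finite_of_discrete).toFinset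

/-- Membership in `nbSet` from the defining bound. [formal bookkeeping] -/
theorem mem_nbSet_of {N₀ : Finset (Cell 2 × ℤ)} {X Y : Cell 2 × ℤ} (hX : X ∈ N₀) (hY : dist Y X ≤ 1) : Y ∈ nbSet N₀ :=
  Finset.mem_biUnion.mpr ⟨X, hX, ((isCompact_closedBall X (1 : ℝ)).finite_of_discrete).mem_toFinset.mpr (mem_closedBall.mpr hY)⟩

/-! ### UT.4  `nnFormZ` and `idxEnergy` of a field supported in a finite set are finite sums -/

/-- the summand of `nnFormZ`. [this file, g57] -/
def nnFam (χ : Cell 2 → ℤ → E3) (x : (Cell 2 × ℤ) × (Cell 2 × ℤ)) : ℝ :=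
  if dist x.1 x.2 ≤ 1 then ‖χ x.2.1 x.2.2 - χ x.1.1 x.1.2‖ ^ 2 else 0

/-- `nnFormZ` as a `finsum` of the family `nnFam`. [formal bookkeeping] -/
theorem nnFormZ_eq_finsum_nnFam (χ : Cell 2 → ℤ → E3) : nnFormZ χ = ∑ᶠ x, nnFam χ x := rfl

/-- The family `nnFam` is non-negative. [formal bookkeeping] -/
theorem nnFam_nonneg (χ : Cell 2 → ℤ → E3) (x : (Cell 2 × ℤ) × (Cell 2 × ℤ)) : 0 ≤ nnFam χ x := by
  unfold nnFam; split_ifs <;> positivity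

/-- `nnFormZ` is non-negative. [formal bookkeeping] -/
theorem nnFormZ_nonneg (χ : Cell 2 → ℤ → E3) : 0 ≤ nnFormZ χ :=
  finsum_nonneg fun x => nnFam_nonneg χ x

/-- The support of `nnFam` is contained in the near set. [formal bookkeeping] -/
theorem support_nnFam_subset {N₀ : Finset (Cell 2 × ℤ)} {χ : Cell 2 → ℤ → E3} (hχ : ∀ X : Cell 2 × ℤ, X ∉ N₀ → χ X.1 X.2 = 0) :
    Function.support (nnFam χ) ⊆ ↑(nbSet N₀ ×ˢ nbSet N₀) := by
  intro x hx
  rw [Function.mem_support] at hx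
  unfold nnFam at hx
  by_cases hd : dist x.1 x.2 ≤ 1
  · rw [if_pos hd] at hx
    have hne : χ x.2.1 x.2.2 - χ x.1.1 x.1.2 ≠ 0 := fun h0 => hx (by rw [h0, norm_zero]; norm_num)
    rw [Finset.coe_product]
    by_cases h1 : x.1 ∈ N₀
    · exact ⟨mem_nbSet_of h1 (by rw [dist_self]; exact zero_le_one), mem_nbSet_of h1 (by rw [dist_comm]; exact hd)⟩
    · have h2 : x.2 ∈ N₀ := by
        by_contra h2
        exact hne (by rw [hχ x.1 h1, hχ x.2 h2, sub_zero])
      exact ⟨mem_nbSet_of h2 hd, mem_nbSet_of h2 (by rw [dist_self]; exact zero_le_one)⟩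
  · exact absurd (if_neg hd) hx

/-- `nnFormZ` as a finite sum. [formal bookkeeping] -/
theorem nnFormZ_eq_sum {N₀ : Finset (Cell 2 × ℤ)} {χ : Cell 2 → ℤ → E3} (hχ : ∀ X : Cell 2 × ℤ, X ∉ N₀ → χ X.1 X.2 = 0) :
    nnFormZ χ = ∑ x ∈ nbSet N₀ ×ˢ nbSet N₀, nnFam χ x :=
  finsum_eq_sum_of_support_subset _ (support_nnFam_subset hχ)

/-- ★ the localised index energy of a finitely supported field is at most its `nnFormZ` (same nonnegative summand over fewer pairs). [this file, g57] -/
theorem idxEnergy_le_nnFormZ {N₀ : Finset (Cell 2 × ℤ)} {χ : Cell 2 → ℤ → E3} (hχ : ∀ X : Cell 2 × ℤ, X ∉ N₀ → χ X.1 X.2 = 0)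
    (B : Set (Cell 2 × ℤ)) : idxEnergy χ B ≤ nnFormZ χ := by
  have hsub := support_nnFam_subset hχ
  have hle : ∀ x : (Cell 2 × ℤ) × (Cell 2 × ℤ),
      Set.indicator {x : (Cell 2 × ℤ) × (Cell 2 × ℤ) | x.1 ∈ B ∧ x.2 ∈ B ∧ dist x.1 x.2 ≤ 1}
        (fun x => ‖χ x.2.1 x.2.2 - χ x.1.1 x.1.2‖ ^ 2) x ≤ nnFam χ x := by
    intro x
    by_cases hx : x ∈ {x : (Cell 2 × ℤ) × (Cell 2 × ℤ) | x.1 ∈ B ∧ x.2 ∈ B ∧ dist x.1 x.2 ≤ 1}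
    · rw [Set.indicator_of_mem hx]
      unfold nnFam
      rw [if_pos hx.2.2]
    · rw [Set.indicator_of_notMem hx]
      exact nnFam_nonneg χ x
  have hsub' : Function.support (Set.indicator {x : (Cell 2 × ℤ) × (Cell 2 × ℤ) | x.1 ∈ B ∧ x.2 ∈ B ∧ dist x.1 x.2 ≤ 1}
      (fun x => ‖χ x.2.1 x.2.2 - χ x.1.1 x.1.2‖ ^ 2)) ⊆ ↑(nbSet N₀ ×ˢ nbSet N₀) := by
    intro x hx
    have hx' := Set.indicator_apply_ne_zero.mp hx
    apply hsub
    rw [Function.mem_support]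
    unfold nnFam
    rw [if_pos hx'.1.2.2]
    exact hx'.2
  unfold idxEnergy
  rw [finsum_mem_def, finsum_eq_sum_of_support_subset _ hsub', nnFormZ_eq_sum hχ]
  exact Finset.sum_le_sum fun x _ => hle x

/-- ★ POSITIVITY: a field supported in a finite set with vanishing `nnFormZ` vanishes (every index-nearest-neighbour increment is zero, so the
field is constant along the layer ray from any site, and the ray leaves the finite set). [this file, g57] -/
theorem eq_zero_of_nnFormZ_eq_zero {N₀ : Finset (Cell 2 × ℤ)} {χ : Cell 2 → ℤ → E3}
    (hχ : ∀ X : Cell 2 × ℤ, X ∉ N₀ → χ X.1 X.2 = 0) (h0 : nnFormZ χ = 0) (X : Cell 2 × ℤ) : χ X.1 X.2 = 0 := by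
  have hall : ∀ x : (Cell 2 × ℤ) × (Cell 2 × ℤ), nnFam χ x = 0 := by
    intro x
    by_cases hx : x ∈ nbSet N₀ ×ˢ nbSet N₀
    · rw [nnFormZ_eq_sum hχ] at h0
      exact (Finset.sum_eq_zero_iff_of_nonneg fun y _ => nnFam_nonneg χ y).mp h0 x hx
    · by_contra hne
      exact hx (support_nnFam_subset hχ (Function.mem_support.mpr hne))
  have hstep : ∀ n : ℕ, χ X.1 (X.2 + ((n + 1 : ℕ) : ℤ)) = χ X.1 (X.2 + (n : ℤ)) := by
    intro n
    have hd : dist ((X.1, X.2 + (n : ℤ)) : Cell 2 × ℤ) (X.1, X.2 + ((n + 1 : ℕ) : ℤ)) ≤ 1 := by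
      rw [Prod.dist_eq, dist_self, Int.dist_eq]
      have : ((X.2 + (n : ℤ) : ℤ) : ℝ) - ((X.2 + ((n + 1 : ℕ) : ℤ) : ℤ) : ℝ) = -1 := by push_cast; ring
      rw [this, abs_neg, abs_one, max_eq_right zero_le_one]
    have h := hall ((X.1, X.2 + (n : ℤ)), (X.1, X.2 + ((n + 1 : ℕ) : ℤ)))
    unfold nnFam at h
    dsimp only at h
    rw [if_pos hd] at h
    have h' : ‖χ X.1 (X.2 + ((n + 1 : ℕ) : ℤ)) - χ X.1 (X.2 + (n : ℤ))‖ = 0 := by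
      rcases (pow_eq_zero_iff two_ne_zero).mp h with h''
      exact h''
    exact sub_eq_zero.mp (norm_eq_zero.mp h')
  have hconst : ∀ n : ℕ, χ X.1 (X.2 + (n : ℤ)) = χ X.1 X.2 := by
    intro n
    induction n with
    | zero => simp
    | succ n ih => rw [hstep n, ih]
  obtain ⟨n, hn⟩ : ∃ n : ℕ, ((X.1, X.2 + (n : ℤ)) : Cell 2 × ℤ) ∉ N₀ := by
    by_contra hcon
    simp only [not_exists, not_not] at hcon
    refine not_injective_infinite_finite (fun n : ℕ => (⟨(X.1, X.2 + (n : ℤ)), hcon n⟩ : ↥N₀)) ?_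
    intro m n hmn
    have h2 := congrArg (fun p : ↥N₀ => (p : Cell 2 × ℤ).2) hmn
    simpa using h2
  rw [← hconst n]
  exact hχ _ hn

/-! ### UT.5  The truncated form: near part finite, far part `(T)`-small, coercive by `CoerciveZ` -/

/-- the pair family of `CoerciveZ` for the layered kernel. [this file, g57] -/
def pairFam (a b : E3) (w : ℤ → E3) (χ : Cell 2 → ℤ → E3) (x : (Cell 2 × ℤ) × (Cell 2 × ℤ)) : ℝ :=
  ⟪χ x.2.1 x.2.2 - χ x.1.1 x.1.2, layeredKernel a b w (x.2.1 - x.1.1) x.1.2 x.2.2 (χ x.2.1 x.2.2 - χ x.1.1 x.1.2)⟫_ℝ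

/-- its `ϱ`-NEAR part (the truncated quadratic form's summand). [this file, g57] -/
def nearFam (ϱ : ℝ) (a b : E3) (w : ℤ → E3) (χ : Cell 2 → ℤ → E3) (x : (Cell 2 × ℤ) × (Cell 2 × ℤ)) : ℝ :=
  ⟪χ x.2.1 x.2.2 - χ x.1.1 x.1.2, nearK ϱ a b w x.1 x.2 (χ x.2.1 x.2.2 - χ x.1.1 x.1.2)⟫_ℝ

/-- its `ϱ`-FAR part. [this file, g57] -/
def farFam (ϱ : ℝ) (a b : E3) (w : ℤ → E3) (χ : Cell 2 → ℤ → E3) (x : (Cell 2 × ℤ) × (Cell 2 × ℤ)) : ℝ :=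
  if ϱ < ‖lsite a b w x.2.1 x.2.2 - lsite a b w x.1.1 x.1.2‖ then pairFam a b w χ x else 0

/-- (T)'s tail family. [this file, g57] -/
def tailFam (ϱ : ℝ) (a b : E3) (w : ℤ → E3) (χ : Cell 2 → ℤ → E3) (x : (Cell 2 × ℤ) × (Cell 2 × ℤ)) : ℝ :=
  if ϱ < ‖lsite a b w x.2.1 x.2.2 - lsite a b w x.1.1 x.1.2‖ then
    ‖layeredKernel a b w (x.2.1 - x.1.1) x.1.2 x.2.2‖ * ‖χ x.2.1 x.2.2 - χ x.1.1 x.1.2‖ ^ 2 else 0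

/-- Splitting of `pairFam` into near and far parts. [formal bookkeeping] -/
theorem pairFam_eq_add (ϱ : ℝ) (a b : E3) (w : ℤ → E3) (χ : Cell 2 → ℤ → E3) (x : (Cell 2 × ℤ) × (Cell 2 × ℤ)) :
    pairFam a b w χ x = nearFam ϱ a b w χ x + farFam ϱ a b w χ x := by
  unfold nearFam farFam nearK pairFam
  split_ifs with h
  · rw [inner_zero_right, zero_add]
  · rw [add_zero]

/-- Norm bound for the far family. [formal bookkeeping] -/
theorem norm_farFam_le (ϱ : ℝ) (a b : E3) (w : ℤ → E3) (χ : Cell 2 → ℤ → E3) (x : (Cell 2 × ℤ) × (Cell 2 × ℤ)) :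
    ‖farFam ϱ a b w χ x‖ ≤ tailFam ϱ a b w χ x := by
  unfold farFam tailFam pairFam
  split_ifs with h
  · rw [Real.norm_eq_abs]
    refine (abs_real_inner_le_norm _ _).trans ?_
    calc ‖χ x.2.1 x.2.2 - χ x.1.1 x.1.2‖ * ‖layeredKernel a b w (x.2.1 - x.1.1) x.1.2 x.2.2 (χ x.2.1 x.2.2 - χ x.1.1 x.1.2)‖
        ≤ ‖χ x.2.1 x.2.2 - χ x.1.1 x.1.2‖ * (‖layeredKernel a b w (x.2.1 - x.1.1) x.1.2 x.2.2‖ * ‖χ x.2.1 x.2.2 - χ x.1.1 x.1.2‖) :=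
          mul_le_mul_of_nonneg_left (ContinuousLinearMap.le_opNorm _ _) (norm_nonneg _)
      _ = ‖layeredKernel a b w (x.2.1 - x.1.1) x.1.2 x.2.2‖ * ‖χ x.2.1 x.2.2 - χ x.1.1 x.1.2‖ ^ 2 := by ring
  · rw [norm_zero]

/-- The near family vanishes off the near set. [formal bookkeeping] -/
theorem nearFam_eq_zero_of_not_mem (hc : 0 < c) (hL : IsLayeredCrystal c a b w) {ϱ : ℝ} {N₀ : Finset (Cell 2 × ℤ)}
    {χ : Cell 2 → ℤ → E3} (hχ : ∀ X : Cell 2 × ℤ, X ∉ N₀ → χ X.1 X.2 = 0) :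
    ∀ x : (Cell 2 × ℤ) × (Cell 2 × ℤ), x ∉ nearSet hc hL ϱ N₀ ×ˢ nearSet hc hL ϱ N₀ → nearFam ϱ a b w χ x = 0 := by
  intro x hx
  unfold nearFam nearK
  by_cases hfar : ϱ < ‖lsite a b w x.2.1 x.2.2 - lsite a b w x.1.1 x.1.2‖
  · rw [if_pos hfar, inner_zero_right]
  · rw [if_neg hfar]
    have hnear := not_lt.mp hfar
    have hϱ : 0 ≤ ϱ := (norm_nonneg _).trans hnear
    by_cases h1 : x.1 ∈ N₀
    · exact absurd (Finset.mem_product.mpr ⟨mem_nearSet_self hc hL hϱ h1, mem_nearSet_of hc hL h1 hnear⟩) hx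
    · by_cases h2 : x.2 ∈ N₀
      · exact absurd (Finset.mem_product.mpr
          ⟨mem_nearSet_of hc hL h2 (by rw [norm_sub_rev]; exact hnear), mem_nearSet_self hc hL hϱ h2⟩) hx
      · rw [hχ x.1 h1, hχ x.2 h2, sub_zero, map_zero, inner_zero_right]

/-- ★ COERCIVITY OF THE TRUNCATED FORM (`CoerciveZ` minus the (T)-tail): for `χ` supported in the finite set `N₀`,
`(2κ₀ − ε) · nnFormZ χ ≤ Q_ϱ(χ) = Σ_{near pairs} ⟪χ Y − χ X, nearK X Y (χ Y − χ X)⟫`. [this file, g57] -/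
theorem truncForm_coercive (hc : 0 < c) (hL : IsLayeredCrystal c a b w) {κ₀ ε ϱ : ℝ} (hK : CoerciveZ (layeredKernel a b w) κ₀)
    {χ : Cell 2 → ℤ → E3} {N₀ : Finset (Cell 2 × ℤ)} (hχ : ∀ X : Cell 2 × ℤ, X ∉ N₀ → χ X.1 X.2 = 0)
    (hT : Summable (tailFam ϱ a b w χ) ∧ ∑' x, tailFam ϱ a b w χ x ≤ ε * nnFormZ χ) :
    (2 * κ₀ - ε) * nnFormZ χ ≤ ∑ x ∈ nearSet hc hL ϱ N₀ ×ˢ nearSet hc hL ϱ N₀, nearFam ϱ a b w χ x := by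
  have hfs : HasFiniteSupport χ := ⟨N₀, fun γ m h => hχ (γ, m) h⟩
  have hnear : HasSum (nearFam ϱ a b w χ) (∑ x ∈ nearSet hc hL ϱ N₀ ×ˢ nearSet hc hL ϱ N₀, nearFam ϱ a b w χ x) :=
    hasSum_sum_of_ne_finset_zero (nearFam_eq_zero_of_not_mem hc hL hχ)
  have hfarS : Summable (farFam ϱ a b w χ) := Summable.of_norm_bounded hT.1 (norm_farFam_le ϱ a b w χ)
  have hle : ∑' x, farFam ϱ a b w χ x ≤ ε * nnFormZ χ :=
    (Summable.tsum_le_tsum (fun x => (le_abs_self _).trans ((Real.norm_eq_abs _).symm.le.trans (norm_farFam_le ϱ a b w χ x)))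
      hfarS hT.1).trans hT.2
  have heq : pairFam a b w χ = fun x => nearFam ϱ a b w χ x + farFam ϱ a b w χ x := funext (pairFam_eq_add ϱ a b w χ)
  have hsum : HasSum (pairFam a b w χ)
      ((∑ x ∈ nearSet hc hL ϱ N₀ ×ˢ nearSet hc hL ϱ N₀, nearFam ϱ a b w χ x) + ∑' x, farFam ϱ a b w χ x) := by
    rw [heq]
    exact hnear.add hfarS.hasSum
  have hco : κ₀ * nnFormZ χ ≤ ((∑ x ∈ nearSet hc hL ϱ N₀ ×ˢ nearSet hc hL ϱ N₀, nearFam ϱ a b w χ x) + ∑' x, farFam ϱ a b w χ x) / 2 :=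
    hK χ hfs _ hsum
  nlinarith [hco, hle]

end DirichletSolve

end Summit.AtomisticToContinuum.Crystallization.Theorems.ChartedZeroExcessLayeredLatticeLiouville

end
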